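import Summits.QuantumFields.YangMills.Theorems.ParabolicTrajectoryContinuumLimitOnTrajectoryUclVarD
import Literature.MathematicalPhysics.QuantumLattice.SchwartzHalfSpaceCutoffA

/-!
# Crux `ContinuumLimitOnTrajectory` (stmt-QuantumFields-10522), line `two-orbit-synchronisation` (seat c2):
# `VarBound` from `UUVB`, explicit form (wave-2 helper W2-VAR of `stub_uclOfGap : UCLOfGap`, part E)

Helper file (`--supports stmt-QuantumFields-10522`): the OS-variance input `VarBound r sch` of the main term of the clustering
leg (…UclDefs) follows from the uniform-threshold plaquette-string bounds `UUVB r sch` (…DefsC). This file proves it in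
EXPLICIT form — the statement of `VarBound` with its one piece of …UclDefs vocabulary, the plane reflection
`planeRefl sch k T U = τ_{−T} (Θ' (τ_T U))`, written out — so that it does not wait for …UclDefs; the one-line wrapper
`varBound_of_uuvb : UUVB r sch → VarBound r sch` is …UclVar. Assembly of …UclVarA–D:
1. (`Var.pairing_planeRefl_eq`, …UclVarA) time-shift invariance of Wilson's torus measure moves the reflection plane `T` to `0`, where
   worker A's exact reflection `Arp.lat_negReflect` turns `conj (obsOf Φ' ∘ τ_{−T} ∘ Θ' ∘ τ_T)` into the lattice functional of the
   REFLECTED centred corner densities against `conj θΦ'_T`, `Φ'_T = T_{−a_k T e₀} Φ'` (the `/8` margins keep every box string in the box);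
2. (…UclVarD) at every step beyond ONE threshold (`UUVB` at `k`, `a_k ≤ 1`, `a_k L_k ≥ 2`) the pairing is bounded by
   `C |Φ'_T|_{sV} |conj θΦ'_T|_{sV}`, `sV = 2ps + 16p`: plaquette-string expansion of both factors (worker A's time-chirality
   formula), Taylor expansion of the slot-translated test functions of the reflected factor (…UclVarB) — main terms off-diagonal
   (the two factors live at opposite signs of time since the plane is `≥ R₀ + 2` lattice units off the window) and bounded by
   `UUVB`, remainders `O(a_k^{8p})` against the `a_k^{−8p}` of counting (…UclVarC);
3. `|conj θΦ'_T|_m ≤ |Φ'_T|_m ≤ (2(1 + |a_k T|))^m |Φ'|_m`: the bound is `C 4^{sV} (1 + |a_k T|)^{2 sV} |Φ'|²_{sV}`.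
No new definitions.
-/

set_option autoImplicit false

open scoped SchwartzMap ComplexConjugate
open MeasureTheory Filter Topology
open Literature.MathematicalPhysics.QuantumFieldTheory Literature.MathematicalPhysics.QuantumLattice
open Literature.MathematicalPhysics.AQFT Literature.Probability.LatticeModels

noncomputable section

namespace Summit.QuantumFields.YangMills.Cruxes.ContinuumLimitOnTrajectory.TwoOrbitSynchronisation

namespace Var

section Final

variable {G : Type} [Group G] [TopologicalSpace G] [IsTopologicalGroup G] [CompactSpace G]
  [MeasurableSpace G] [BorelSpace G]

/-- The norm of the embedded lattice time vector `c e₀` is `|c|`. -/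
theorem norm_siteToE_single (c : ℤ) : ‖(siteToE (Pi.single 0 c : Site 4) : EuclideanSpace ℝ (Fin 4))‖ = |(c : ℝ)| := by
  have h1 : (siteToE (Pi.single 0 c : Site 4) : EuclideanSpace ℝ (Fin 4)) = EuclideanSpace.single 0 (c : ℝ) := by
    ext j
    by_cases hj : j = 0
    · subst hj; simp [siteToE_apply]
    · simp [siteToE_apply, hj]
  rw [h1, PiLp.norm_single, Real.norm_eq_abs]

/-- The conjugated reflected test function avoids the coincidence locus if the original does. -/
theorem avoidsLocus_Ftil {p : ℕ} {F : 𝓢((Fin p → EuclideanSpace ℝ (Fin 4)), ℂ)} (hF : AvoidsLocus F) : AvoidsLocus (Arp.Ftil F) := by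
  intro x hx hxl
  have hx' := tsupport_starTest_thetaMulti_subset F hx
  obtain ⟨i, j, hij, hxij⟩ := hxl
  exact hF hx' ⟨i, j, hij, by simp [hxij]⟩

omit [TopologicalSpace G] [IsTopologicalGroup G] [CompactSpace G] [BorelSpace G] in
/-- The time window of the shifted test function `Φ_T = T_{−a_k T e₀} Φ`: `[θlo − a_k T, θhi − a_k T]`. -/
theorem tsupport_shifted (sch : SpeciesScheme (YMSpecies G)) (k : ℕ) (T : ℤ) {p : ℕ} (Φ : 𝓢((Fin p → EuclideanSpace ℝ (Fin 4)), ℂ))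
    {θlo θhi : ℝ} (hΦ : tsupport (Φ : (Fin p → EuclideanSpace ℝ (Fin 4)) → ℂ) ⊆ {x | ∀ j, θlo ≤ x j 0 ∧ x j 0 ≤ θhi}) :
    tsupport ((translateMulti (sch.a k • siteToE (Pi.single 0 (-T) : Site 4)) Φ : 𝓢((Fin p → EuclideanSpace ℝ (Fin 4)), ℂ)) :
        (Fin p → EuclideanSpace ℝ (Fin 4)) → ℂ) ⊆
      {x | ∀ j, θlo ≤ x j 0 + sch.a k * T ∧ x j 0 + sch.a k * T ≤ θhi} := by
  intro x hx j
  have h := hΦ (tsupport_translateMulti_subset_preimage _ Φ hx) j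
  have h0 : (sch.a k • siteToE (Pi.single 0 (-T) : Site 4) : EuclideanSpace ℝ (Fin 4)) 0 = -(sch.a k * T) := by simp [siteToE_apply]
  simp only [PiLp.sub_apply, h0, sub_neg_eq_add] at h
  exact h

omit [TopologicalSpace G] [IsTopologicalGroup G] [CompactSpace G] [BorelSpace G] in
/-- The time window of `conj θΦ_T`: `[a_k T − θhi, a_k T − θlo]`. -/
theorem tsupport_Ftil_shifted (sch : SpeciesScheme (YMSpecies G)) (k : ℕ) (T : ℤ) {p : ℕ} (Φ : 𝓢((Fin p → EuclideanSpace ℝ (Fin 4)), ℂ))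
    {θlo θhi : ℝ} (hΦ : tsupport (Φ : (Fin p → EuclideanSpace ℝ (Fin 4)) → ℂ) ⊆ {x | ∀ j, θlo ≤ x j 0 ∧ x j 0 ≤ θhi}) :
    tsupport ((Arp.Ftil (translateMulti (sch.a k • siteToE (Pi.single 0 (-T) : Site 4)) Φ) : 𝓢((Fin p → EuclideanSpace ℝ (Fin 4)), ℂ)) :
        (Fin p → EuclideanSpace ℝ (Fin 4)) → ℂ) ⊆
      {x | ∀ j, θlo ≤ -x j 0 + sch.a k * T ∧ -x j 0 + sch.a k * T ≤ θhi} := by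
  intro x hx j
  have h := tsupport_shifted sch k T Φ hΦ (tsupport_starTest_thetaMulti_subset _ hx) j
  simpa [timeReflection_apply] using h

/-- **`VarBound` from `UUVB`, explicit form** (the statement of `VarBound r sch` of …UclDefs with `planeRefl` written out;
see the file header for the route). -/
theorem varBound_explicit_of_uuvb' (r : LatticeRep G) (sch : SpeciesScheme (YMSpecies G)) (hU : UUVB r sch) :
    ∀ p : ℕ, ∃ (s'' κ : ℕ) (C : ℝ), 0 ≤ C ∧ ∀ᶠ k in atTop, ∀ (Φ' : 𝓢((Fin p → EuclideanSpace ℝ (Fin 4)), ℂ)) (T : ℤ) (θlo θhi : ℝ),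
      AvoidsLocus Φ' → tsupport (Φ' : (Fin p → EuclideanSpace ℝ (Fin 4)) → ℂ) ⊆ {x | ∀ j, θlo ≤ x j 0 ∧ x j 0 ≤ θhi} →
      (⌊θhi / sch.a k⌋ + (timeRadius r.curvature : ℤ) + 2 ≤ T ∨ T ≤ ⌈θlo / sch.a k⌉ - (timeRadius r.curvature : ℤ) - 2) →
      |θlo| ≤ sch.a k * sch.L k / 8 → |θhi| ≤ sch.a k * sch.L k / 8 → |sch.a k * T| ≤ sch.a k * sch.L k / 8 →
        ‖∫ U, obsOf r sch k p Φ' U * conj (obsOf r sch k p Φ' (timeShiftInt (sch.side k) (-T) (timeShiftInt (sch.side k) T U).negReflect)) ∂(μW r sch k)‖ ≤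
          C * (1 + |sch.a k * T|) ^ κ * (schwartzNorm s'' Φ') ^ 2 := by
  obtain ⟨s, α, β, hUev⟩ := hU
  intro p
  set α' := max α 0 with hα'
  have hα'0 : 0 ≤ α' := le_max_right _ _
  obtain ⟨C, hC0, hC⟩ := exists_pairing_bound r p s β hα'0
  set sV := (p + p) * s + 16 * p with hsV
  refine ⟨sV, 2 * sV, C * 4 ^ sV, mul_nonneg hC0 (by positivity), ?_⟩
  have h2 : ∀ᶠ k in atTop, sch.a k ≤ 1 := sch.tendsto_a.eventually (eventually_le_nhds one_pos)
  have h3 : ∀ᶠ k in atTop, (2 : ℝ) ≤ sch.a k * sch.L k := sch.tendsto_L.eventually_ge_atTop 2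
  filter_upwards [hUev, h2, h3] with k hUk ha1 haL2
  intro Φ T θlo θhi hal hsupp hplane hlo hhi hTa
  have ha := sch.a_pos k
  -- `UUVB` at `k` with the non-negative constant `α'`
  have hU' : ∀ (p' : ℕ) (σ : Fin p' → PlaqIdx) (K : 𝓢((Fin p' → EuclideanSpace ℝ (Fin 4)), ℂ)), IsOffDiagonal K →
      ‖canonDistribution r sch k p' (fun i => plaq r (σ i)) K‖ ≤ α' * (p'.factorial : ℝ) ^ β * schwartzNorm (p' * s) K :=
    fun p' σ K hK => (hUk p' σ K hK).trans (mul_le_mul_of_nonneg_right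
      (mul_le_mul_of_nonneg_right (le_max_left _ _) (Real.rpow_nonneg (Nat.cast_nonneg _) β)) (schwartzNorm_nonneg _ _))
  -- the window of `Φ` and the first margin
  set Tb := max |θlo| |θhi| with hTb
  have hΦb : ∀ x, Φ x ≠ 0 → ∀ i, |x i 0| ≤ Tb := fun x hx i =>
    have h := hsupp (subset_tsupport _ (Function.mem_support.2 hx)) i
    abs_le_max_abs_abs h.1 h.2
  have hTb8 : Tb ≤ sch.a k * sch.L k / 8 := max_le hlo hhi
  have haT : sch.a k * |(T : ℝ)| = |sch.a k * T| := by rw [abs_mul, abs_of_pos ha]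
  have hT1 : Tb + sch.a k * |(T : ℝ)| ≤ sch.a k * sch.L k := by rw [haT]; linarith
  rw [pairing_planeRefl_eq r sch k p Φ T hΦb hT1]
  set F := translateMulti (sch.a k • siteToE (Pi.single 0 (-T) : Site 4)) Φ with hF_def
  have hFal : AvoidsLocus F := hal.translateMulti _
  have hGal : AvoidsLocus (Arp.Ftil F) := avoidsLocus_Ftil hFal
  have hFs := tsupport_shifted sch k T Φ hsupp
  have hGs := tsupport_Ftil_shifted sch k T Φ hsupp
  -- the window of `conj θΦ_T` and the second margin
  have hGb : ∀ x, Arp.Ftil F x ≠ 0 → ∀ i, |x i 0| ≤ Tb + |sch.a k * T| := by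
    intro x hx i
    have h := hGs (subset_tsupport _ (Function.mem_support.2 hx)) i
    have h1 : |θlo| ≤ Tb := le_max_left _ _
    have h2 : |θhi| ≤ Tb := le_max_right _ _
    rw [abs_le]
    constructor
    · linarith [le_abs_self θhi, neg_abs_le (sch.a k * T), h.2]
    · linarith [neg_abs_le θlo, le_abs_self (sch.a k * T), h.1]
  have hT2 : Tb + |sch.a k * T| + sch.a k ≤ sch.a k * sch.L k := by linarith
  -- the two factors live at opposite signs of time
  obtain ⟨P, hFP, hGP⟩ : ∃ P : ℝ → Prop, tsupport (F : (Fin p → EuclideanSpace ℝ (Fin 4)) → ℂ) ⊆ {x | ∀ j, P (x j 0)} ∧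
      tsupport ((Arp.Ftil F : 𝓢((Fin p → EuclideanSpace ℝ (Fin 4)), ℂ)) : (Fin p → EuclideanSpace ℝ (Fin 4)) → ℂ) ⊆ {y | ∀ j, ¬ P (y j 0)} := by
    rcases hplane with hA | hB
    · have hAT : θhi < sch.a k * T := by
        have h1 : ((⌊θhi / sch.a k⌋ : ℤ) : ℝ) + (timeRadius r.curvature : ℝ) + 2 ≤ T := by exact_mod_cast hA
        have h2 : θhi / sch.a k < ⌊θhi / sch.a k⌋ + 1 := Int.lt_floor_add_one _
        have h3 : (0 : ℝ) ≤ timeRadius r.curvature := Nat.cast_nonneg _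
        have h4 : θhi / sch.a k < T := by linarith
        rw [div_lt_iff₀ ha] at h4
        linarith
      refine ⟨fun t => t < 0, fun x hx j => ?_, fun y hy j => ?_⟩
      · have := (hFs hx j).2
        show x j 0 < 0
        linarith
      · have := (hGs hy j).2
        show ¬ (y j 0 < 0)
        linarith
    · have hBT : sch.a k * T < θlo := by
        have h1 : (T : ℝ) ≤ ((⌈θlo / sch.a k⌉ : ℤ) : ℝ) - (timeRadius r.curvature : ℝ) - 2 := by exact_mod_cast hB
        have h2 : (⌈θlo / sch.a k⌉ : ℝ) < θlo / sch.a k + 1 := Int.ceil_lt_add_one _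
        have h3 : (0 : ℝ) ≤ timeRadius r.curvature := Nat.cast_nonneg _
        have h4 : (T : ℝ) < θlo / sch.a k := by linarith
        rw [lt_div_iff₀ ha] at h4
        linarith
      refine ⟨fun t => 0 < t, fun x hx j => ?_, fun y hy j => ?_⟩
      · have := (hFs hx j).1
        show 0 < x j 0
        linarith
      · have := (hGs hy j).1
        show ¬ (0 < y j 0)
        linarith
  refine (hC sch k hU' ha1 F (Arp.Ftil F) hFal hGal P hFP hGP _ hGb hT2).trans ?_
  -- Schwartz norms of `Φ_T` and `conj θΦ_T` in terms of `Φ`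
  have hnF : schwartzNorm sV F ≤ (2 * (1 + |sch.a k * T|)) ^ sV * schwartzNorm sV Φ := by
    have h := schwartzNorm_translateMulti_le sV (sch.a k • siteToE (Pi.single 0 (-T) : Site 4) : EuclideanSpace ℝ (Fin 4)) Φ
    have hn : ‖(sch.a k • siteToE (Pi.single 0 (-T) : Site 4) : EuclideanSpace ℝ (Fin 4))‖ = |sch.a k * T| := by
      rw [norm_smul, norm_siteToE_single, Real.norm_eq_abs, Int.cast_neg, abs_neg, ← abs_mul]
    rw [hn] at h
    exact h
  have hnG : schwartzNorm sV (Arp.Ftil F) ≤ (2 * (1 + |sch.a k * T|)) ^ sV * schwartzNorm sV Φ :=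
    (schwartzNorm_starTest_thetaMulti_le F _).trans hnF
  have hX0 := schwartzNorm_nonneg sV Φ
  have hsq : (2 * (1 + |sch.a k * T|)) ^ sV * (2 * (1 + |sch.a k * T|)) ^ sV =
      4 ^ sV * (1 + |sch.a k * T|) ^ (2 * sV) := by
    rw [← mul_pow, pow_mul, ← mul_pow]
    congr 1
    ring
  calc C * schwartzNorm sV F * schwartzNorm sV (Arp.Ftil F)
      ≤ C * ((2 * (1 + |sch.a k * T|)) ^ sV * schwartzNorm sV Φ) * ((2 * (1 + |sch.a k * T|)) ^ sV * schwartzNorm sV Φ) :=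
        mul_le_mul (mul_le_mul_of_nonneg_left hnF hC0) hnG (schwartzNorm_nonneg _ _) (mul_nonneg hC0 (by positivity))
    _ = C * ((2 * (1 + |sch.a k * T|)) ^ sV * (2 * (1 + |sch.a k * T|)) ^ sV) * schwartzNorm sV Φ ^ 2 := by ring
    _ = C * 4 ^ sV * (1 + |sch.a k * T|) ^ (2 * sV) * schwartzNorm sV Φ ^ 2 := by rw [hsq]; ring

end Final

end Var

/-- **Registered anchor of this file** (closed form of `Var.varBound_explicit_of_uuvb'`, for the gate's `--supports` stub check):
`VarBound r sch` from `UUVB r sch`, with the plane reflection of …UclDefs written out. -/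
theorem varE_varBound_explicit_of_uuvb :
    ∀ {G : Type} [Group G] [TopologicalSpace G] [IsTopologicalGroup G] [CompactSpace G] [MeasurableSpace G] [BorelSpace G]
      (r : LatticeRep G) (sch : SpeciesScheme (YMSpecies G)), UUVB r sch →
      ∀ p : ℕ, ∃ (s'' κ : ℕ) (C : ℝ), 0 ≤ C ∧ ∀ᶠ k in atTop,
        ∀ (Φ' : 𝓢((Fin p → EuclideanSpace ℝ (Fin 4)), ℂ)) (T : ℤ) (θlo θhi : ℝ), AvoidsLocus Φ' →
        tsupport (Φ' : (Fin p → EuclideanSpace ℝ (Fin 4)) → ℂ) ⊆ {x | ∀ j, θlo ≤ x j 0 ∧ x j 0 ≤ θhi} →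
        (⌊θhi / sch.a k⌋ + (timeRadius r.curvature : ℤ) + 2 ≤ T ∨ T ≤ ⌈θlo / sch.a k⌉ - (timeRadius r.curvature : ℤ) - 2) →
        |θlo| ≤ sch.a k * sch.L k / 8 → |θhi| ≤ sch.a k * sch.L k / 8 → |sch.a k * T| ≤ sch.a k * sch.L k / 8 →
          ‖∫ U, obsOf r sch k p Φ' U * (starRingEnd ℂ) (obsOf r sch k p Φ' (timeShiftInt (sch.side k) (-T) (timeShiftInt (sch.side k) T U).negReflect))
              ∂(μW r sch k)‖ ≤
            C * (1 + |sch.a k * T|) ^ κ * (schwartzNorm s'' Φ') ^ 2 := by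
  intro G _ _ _ _ _ _ r sch hU
  exact Var.varBound_explicit_of_uuvb' r sch hU

end Summit.QuantumFields.YangMills.Cruxes.ContinuumLimitOnTrajectory.TwoOrbitSynchronisation

end
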